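import Literature.NumberTheory.NumberFields.UnramifiedDiscriminant
import Mathlib.NumberTheory.RamificationInertia.Unramified
import HarnessLib

/-!
# `L/K` is unramified at every finite prime iff `|d_L| = |d_K|^{[L:K]}`

Topic `NumberTheory/NumberFields`.  Theorem-only file (no definition, no named fact), continuing
`UnramifiedDiscriminant.lean` (the direction `⟹`, Neukirch III (2.9)–(2.10)) with the converse:
by the discriminant tower `|d_L| = N(𝔇_{L/K}) · |d_K|^{[L:K]}` (Mathlib
`NumberField.natAbs_discr_eq_absNorm_differentIdeal_mul_natAbs_discr_pow`) the equality forces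
`N(𝔇_{L/K}) = 1`, i.e. `𝔇_{L/K} = (1)`, and a prime is ramified iff it divides the different
(Dedekind; Neukirch III (2.6); Mathlib `not_dvd_differentIdeal_iff`).

* `forall_isUnramifiedAt_iff_natAbs_discr_eq` — `(∀ Q, e(Q | 𝓞 K) = 1) ↔ |d_L| = |d_K|^{[L:K]}`;
* `forall_isUnramifiedIn_iff_forall_isUnramifiedAt` — the same condition in Mathlib's
  `Algebra.IsUnramifiedIn (𝓞 L) v` form over the nonzero primes `v` of `K`;
* `forall_isUnramifiedIn_iff_natAbs_discr_eq`.

The point of the numerical form is that it is visibly invariant under ring isomorphisms of `L`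
and of `K` separately (no compatibility needed), which makes "unramified at all finite primes"
trivially transportable.

## References

* J. Neukirch, *Algebraic Number Theory* (1999), Ch. III Thm. (2.6), Thm. (2.9), Cor. (2.10).
  [NeukirchANT1999]
-/

noncomputable section

open NumberField Ideal IsDedekindDomain

namespace Literature.NumberTheory.NumberFields

variable {K L : Type*} [Field K] [NumberField K] [Field L] [NumberField L] [Algebra K L]

/-- **Trivial different ⟹ everywhere unramified** (Neukirch III (2.6), the direction
"`𝔓 ∤ 𝔇 ⟹ 𝔓` unramified"; Mathlib `not_dvd_differentIdeal_iff`).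
[cite: NeukirchANT1999, Ch. III Thm. (2.6)] -/
theorem isUnramifiedAt_of_differentIdeal_eq_top (h : differentIdeal (𝓞 K) (𝓞 L) = ⊤)
    (P : Ideal (𝓞 L)) [P.IsMaximal] : Algebra.IsUnramifiedAt (𝓞 K) P := by
  letI : Algebra (FractionRing (𝓞 K)) (FractionRing (𝓞 L)) := FractionRing.liftAlgebra _ _
  have : Algebra.IsSeparable (FractionRing (𝓞 K)) (FractionRing (𝓞 L)) := by
    refine Algebra.IsSeparable.of_equiv_equiv (FractionRing.algEquiv (𝓞 K) K).symm.toRingEquiv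
      (FractionRing.algEquiv (𝓞 L) L).symm.toRingEquiv ?_
    ext x
    exact IsFractionRing.algEquiv_commutes (FractionRing.algEquiv (𝓞 K) K).symm
      (FractionRing.algEquiv (𝓞 L) L).symm _
  refine not_dvd_differentIdeal_iff.mp fun hdvd => ?_
  rw [h, Ideal.dvd_iff_le, top_le_iff] at hdvd
  exact Ideal.IsMaximal.ne_top inferInstance hdvd

/-- **`|d_L| = |d_K|^{[L:K]}` iff `L/K` is unramified at every finite prime** (Neukirch III
(2.6), (2.9), (2.10): `|d_L| = N(𝔇_{L/K}) |d_K|^{[L:K]}` and `𝔓 ∣ 𝔇_{L/K} ⟺ 𝔓` ramified).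
[cite: NeukirchANT1999, Ch. III Thm. (2.6), Thm. (2.9), Cor. (2.10)] -/
theorem forall_isUnramifiedAt_iff_natAbs_discr_eq :
    (∀ (P : Ideal (𝓞 L)) [P.IsMaximal], Algebra.IsUnramifiedAt (𝓞 K) P) ↔
      (discr L).natAbs = (discr K).natAbs ^ Module.finrank K L := by
  refine ⟨fun h => natAbs_discr_eq_pow_of_forall_isUnramifiedAt h, fun h P _ => ?_⟩
  have htower :=
    NumberField.natAbs_discr_eq_absNorm_differentIdeal_mul_natAbs_discr_pow K (𝓞 K) L (𝓞 L)
  rw [h] at htower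
  have hpos : 0 < (discr K).natAbs ^ Module.finrank K L :=
    pow_pos (Int.natAbs_pos.mpr (discr_ne_zero K)) _
  have h1 : Ideal.absNorm (differentIdeal (𝓞 K) (𝓞 L)) = 1 := by
    have := htower.symm.trans (one_mul _).symm
    exact Nat.eq_of_mul_eq_mul_right hpos this
  exact isUnramifiedAt_of_differentIdeal_eq_top (Ideal.absNorm_eq_one_iff.mp h1) P

/-- Mathlib's `Algebra.IsUnramifiedIn (𝓞 L) v` for every nonzero prime `v` of `K` says the same as
`Algebra.IsUnramifiedAt (𝓞 K) Q` for every maximal `Q ⊆ 𝓞 L` (each such `Q` lies over the nonzero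
prime `Q ∩ 𝓞 K`). [folklore] -/
theorem forall_isUnramifiedIn_iff_forall_isUnramifiedAt :
    (∀ v : HeightOneSpectrum (𝓞 K), Algebra.IsUnramifiedIn (𝓞 L) v.asIdeal) ↔
      ∀ (P : Ideal (𝓞 L)) [P.IsMaximal], Algebra.IsUnramifiedAt (𝓞 K) P := by
  constructor
  · intro h P hP
    have hPbot : P ≠ ⊥ := Ideal.IsMaximal.ne_bot_of_isIntegral_int P
    have hp : P.under (𝓞 K) ≠ ⊥ := mt Ideal.eq_bot_of_comap_eq_bot hPbot
    haveI : (P.under (𝓞 K)).IsPrime := Ideal.IsPrime.under (𝓞 K) P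
    exact h ⟨P.under (𝓞 K), inferInstance, hp⟩ P hP.isPrime ⟨rfl⟩
  · intro h v
    rw [Algebra.isUnramifiedIn_iff_forall_of_isDedekindDomain]
    intro P hP _
    exact h P

/-- **`L/K` is unramified at every nonzero prime of `K` iff `|d_L| = |d_K|^{[L:K]}`.**
[cite: NeukirchANT1999, Ch. III Thm. (2.6), Thm. (2.9), Cor. (2.10)] -/
theorem forall_isUnramifiedIn_iff_natAbs_discr_eq :
    (∀ v : HeightOneSpectrum (𝓞 K), Algebra.IsUnramifiedIn (𝓞 L) v.asIdeal) ↔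
      (discr L).natAbs = (discr K).natAbs ^ Module.finrank K L :=
  forall_isUnramifiedIn_iff_forall_isUnramifiedAt.trans forall_isUnramifiedAt_iff_natAbs_discr_eq

end Literature.NumberTheory.NumberFields

end
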